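import Literature.AlgebraicGeometry.Motives.MixedHodgeStructureCatTateObjects
import Literature.AlgebraicGeometry.Motives.MixedHodgeStructureCatHodgePolynomial
import Literature.AlgebraicGeometry.Motives.MixedHodgeStructureHodgeTateDevissage
import Mathlib.LinearAlgebra.TensorProduct.Finiteness
import HarnessLib

/-!
# Rank-one objects of `MixedHodgeStructureCat` are the Tate objects `ℚ(j)`; invertible objects; `Pic = ℤ`

Layer `Literature/AlgebraicGeometry/Motives` (lane `lit-hodgefound`), continuing g45-#19 (`tateObj`, `tateMulIso : ℚ(i) ⊗ ℚ(j) ≅ ℚ(i+j)`, `tateDualIso : ℚ(j)^∨ ≅ ℚ(−j)`),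
g45-#21 (`hodgePolynomial`, `E(ℚ(j)) = u^{−j}v^{−j}`) and the tree's Hodge–Tate theory (`Motives/MixedHodgeStructureHodgeTateDevissage`: a simple Hodge–Tate structure is a
Tate structure `ℚ(−k)`, Goncharov §4.1).  A ONE-DIMENSIONAL mixed Hodge structure has a single Hodge number `h^{p,q} = 1`, and Hodge symmetry forces `p = q`: it is
Hodge–Tate, hence (being simple) isomorphic to `ℚ(−p)` — Deligne, *Hodge II* 2.1.13: the rank-one objects `ℤ(n)`; Deligne–Milne §1: the invertible objects of a
rigid tensor category.  This file PROVES: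

* §1 **`isHodgeTate_of_finrank_eq_one`** and **`exists_iso_tateObj_of_finrank_eq_one : dim X = 1 → ∃ j, X ≅ ℚ(j)`**; `finrank_tateObj = 1`;
  **`finrank_eq_one_iff_exists_iso_tateObj`**; **`nonempty_tateObj_iso_tateObj_iff : (ℚ(i) ≅ ℚ(j)) ↔ i = j`**; uniqueness of the twist (`existsUnique_iso_tateObj_of_finrank_eq_one`);
* §2 isomorphisms act on `⊗` and `∨` (`tensorMapIso`, `dualMapIso`), `dim (X ⊗ Y) = dim X · dim Y`, `dim X^∨ = dim X`;
* §3 **invertible objects**: `X` is invertible (`∃ Y, X ⊗ Y ≅ ℚ(0)`) iff `dim X = 1` iff `X ≅ ℚ(j)` (`exists_tensorObj_iso_unitObj_iff_finrank_eq_one`), and then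
  **`X ⊗ X^∨ ≅ ℚ(0)`** (`tensorDualIsoUnitOfFinrankEqOne`) — the Picard group of `MixedHodgeStructureCat` is `{ℚ(j)} ≅ ℤ` (`ℚ(i) ⊗ ℚ(j) ≅ ℚ(i+j)`, g45-#19).

Everything is PROVED; no named fact, no instance, no notation.

Sources, verbatim (through the tree's files).  P. Deligne, *Théorie de Hodge II* (1971) [DeligneHodgeII1971], 2.1.13 («le `ℤ`-module de rang un `ℤ(1)` … `ℤ(n)`»), 1.1.6, 1.1.12.
A. B. Goncharov, *Multiple polylogarithms and mixed Tate motives* (2001) [Goncharov2001MultiplePolylogarithms], §4.1 (Hodge–Tate structures; the simple ones are the `ℚ(n)`).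
P. Deligne, J. S. Milne, *Tannakian categories* (1982) [DeligneMilne1982Tannakian], §1 (1.7) (invertible objects `L`, `L ⊗ L^∨ ≅ 1`).  E. Cattani et al. (eds.), *Hodge Theory*
(2014) [CattaniElZeinGriffithsLe2014], §3.2.2.6 (Hodge numbers, symmetry), Ex. 3.2.23 (4).

## Main results

* §1 `sum_pair_hodgeNumber_le_finrank`, **`isHodgeTate_of_finrank_eq_one`**, `finrank_tateObj`, **`exists_iso_tateObj_of_finrank_eq_one`**,
  **`finrank_eq_one_iff_exists_iso_tateObj`**, **`nonempty_tateObj_iso_tateObj_iff`**, **`existsUnique_iso_tateObj_of_finrank_eq_one`**.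
* §2 **`tensorMapIso`**, `tensorMapIso_hom`, **`dualMapIso`**, `dualMapIso_hom`, `finrank_tensorObj`, `finrank_dualObj`.
* §3 **`exists_tensorObj_iso_unitObj_iff_finrank_eq_one`**, **`tensorDualIsoUnitOfFinrankEqOne`**, `finrank_eq_one_of_tensorObj_iso_unitObj`.

## References

* [DeligneHodgeII1971] P. Deligne, Théorie de Hodge II, Publ. Math. IHÉS 40 (1971), 2.1.13, 1.1.6, 1.1.12.
* [Goncharov2001MultiplePolylogarithms] A. B. Goncharov, Multiple polylogarithms and mixed Tate motives (2001), §4.1.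
* [DeligneMilne1982Tannakian] P. Deligne, J. S. Milne, Tannakian categories, in LNM 900 (1982), §1 (1.7).
* [CattaniElZeinGriffithsLe2014] E. Cattani et al. (eds.), Hodge Theory, Princeton Math. Notes 49 (2014), §3.2.2.6, Ex. 3.2.23 (4).

## Provenance

Lane `lit-hodgefound` (summit `HodgeConjecture`), seat `lit-hodgefound-p36` (literature-prover, generation 45, row g45-#23).
-/

noncomputable section

open CategoryTheory CategoryTheory.Limits
open scoped TensorProduct

namespace Literature.AlgebraicGeometry.Motives

universe u

namespace MixedHodgeStructureCat

variable {X X' Y Y' : MixedHodgeStructureCat.{u}} [Module.Finite ℚ X] [Module.Finite ℚ X'] [Module.Finite ℚ Y] [Module.Finite ℚ Y']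

/-! ## §1 Rank one ⟹ Hodge–Tate ⟹ Tate -/

variable (X) in
/-- `h^{a}(X) + h^{b}(X) ≤ dim X` for two distinct bidegrees `a ≠ b` (`Σ_{p,q} h^{p,q} = dim X`). [cite: CattaniElZeinGriffithsLe2014, §3.2.2.6] -/
theorem sum_pair_hodgeNumber_le_finrank {a b : ℤ × ℤ} (hab : a ≠ b) : X.str.hodgeNumber a.1 a.2 + X.str.hodgeNumber b.1 b.2 ≤ Module.finrank ℚ X := by
  classical
  have hfin : (Function.support fun pq : ℤ × ℤ => X.str.hodgeNumber pq.1 pq.2).Finite :=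
    (finite_support_hodgeNumber X).subset fun pq hpq => by
      rw [Function.mem_support] at hpq ⊢
      exact_mod_cast hpq
  set s : Finset (ℤ × ℤ) := insert a (insert b hfin.toFinset) with hs_def
  have hsupp : (Function.support fun pq : ℤ × ℤ => X.str.hodgeNumber pq.1 pq.2) ⊆ ↑s := fun pq hpq => by
    rw [hs_def, Finset.coe_insert, Finset.coe_insert]
    exact Set.mem_insert_of_mem _ (Set.mem_insert_of_mem _ (hfin.mem_toFinset.2 hpq))
  rw [← X.str.finsum_hodgeNumber_eq_finrank, finsum_eq_sum_of_support_subset _ hsupp, ← Finset.sum_pair (f := fun pq : ℤ × ℤ => X.str.hodgeNumber pq.1 pq.2) hab]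
  exact Finset.sum_le_sum_of_subset (Finset.insert_subset_insert a (Finset.singleton_subset_iff.2 (Finset.mem_insert_self b _)))

variable (X) in
/-- **A one-dimensional mixed Hodge structure is Hodge–Tate**: if `h^{p,q} ≠ 0` with `p ≠ q` then also `h^{q,p} = h^{p,q} ≠ 0` (Hodge symmetry) and `h^{p,q} + h^{q,p} ≤ 1`,
a contradiction. [cite: CattaniElZeinGriffithsLe2014, §3.2.2.6] [cite: Goncharov2001MultiplePolylogarithms, §4.1] -/
theorem isHodgeTate_of_finrank_eq_one (hX : Module.finrank ℚ X = 1) : X.str.IsHodgeTate := by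
  intro p q hpq
  by_contra hne
  have hsymm := X.str.hodgeNumber_symm p q
  have hle := sum_pair_hodgeNumber_le_finrank X (a := (p, q)) (b := (q, p)) (fun h => hpq (Prod.ext_iff.1 h).1)
  simp only at hle
  omega

/-- `dim_ℚ ℚ(j) = 1`. [cite: DeligneHodgeII1971, 2.1.13] -/
theorem finrank_tateObj (j : ℤ) : Module.finrank ℚ (tateObj.{u} j) = 1 := by
  change Module.finrank ℚ (ULift.{u} ℚ) = 1
  rw [finrank_ulift, Module.finrank_self]

/-- `dim_ℚ ℚ(0) = 1` (the unit). [cite: DeligneHodgeII1971, 2.1.13] -/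
theorem finrank_unitObj : Module.finrank ℚ unitObj.{u} = 1 := finrank_tateObj 0

variable (X) in
/-- **A one-dimensional mixed Hodge structure is a Tate structure: `dim X = 1 ⟹ X ≅ ℚ(j)` for some `j`** (Hodge–Tate and simple ⟹ `ℚ(−k)`, Goncharov §4.1; Deligne 2.1.13).
[cite: Goncharov2001MultiplePolylogarithms, §4.1] [cite: DeligneHodgeII1971, 2.1.13] -/
theorem exists_iso_tateObj_of_finrank_eq_one (hX : Module.finrank ℚ X = 1) : ∃ j : ℤ, Nonempty (X ≅ tateObj.{u} j) := by
  haveI : Nontrivial X := Module.nontrivial_of_finrank_eq_succ hX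
  obtain ⟨k, f, hf⟩ := (isHodgeTate_of_finrank_eq_one X hX).exists_hom_tate_bijective_of_simple (MixedHodgeStructure.isSimple_of_finrank_eq_one hX X.str).2
  refine ⟨-k, ⟨?_⟩⟩
  let g : tateObj.{u} (-k) ⟶ X := (f.comp (ofTateObj.{u} (-k)) : MixedHodgeStructure.Hom (tateObj.{u} (-k)).str X.str)
  have hg : Function.Bijective (MixedHodgeStructure.Hom.toLinearMap g) := hf.comp (MixedHodgeStructure.Hom.ofEquiv_bijective _ _)
  haveI := isIso_of_bijective g hg
  exact (asIso g).symm

/-- **`ℚ(i) ≅ ℚ(j)` iff `i = j`** (compare `E(ℚ(i)) = u^{−i}v^{−i}`). [cite: DeligneHodgeII1971, 2.1.13] -/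
theorem nonempty_tateObj_iso_tateObj_iff (i j : ℤ) : Nonempty (tateObj.{u} i ≅ tateObj.{u} j) ↔ i = j := by
  refine ⟨fun ⟨e⟩ => ?_, fun h => h ▸ ⟨Iso.refl _⟩⟩
  haveI := finite_tateObj.{u} i
  haveI := finite_tateObj.{u} j
  have h := hodgePolynomial_eq_of_iso e
  rw [hodgePolynomial_tateObj, hodgePolynomial_tateObj] at h
  have h' := congrArg (fun x : AddMonoidAlgebra ℤ (ℤ × ℤ) => x.coeff (-i, -i)) h
  simp only [AddMonoidAlgebra.coeff_single, Finsupp.single_eq_same, Finsupp.single_apply] at h'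
  by_contra hij
  rw [if_neg (fun h0 => hij (neg_injective (Prod.ext_iff.1 h0).1).symm)] at h'
  exact one_ne_zero h'

variable (X) in
/-- **`dim X = 1` iff `X ≅ ℚ(j)` for some `j`.** [cite: DeligneHodgeII1971, 2.1.13] [cite: Goncharov2001MultiplePolylogarithms, §4.1] -/
theorem finrank_eq_one_iff_exists_iso_tateObj : Module.finrank ℚ X = 1 ↔ ∃ j : ℤ, Nonempty (X ≅ tateObj.{u} j) := by
  refine ⟨exists_iso_tateObj_of_finrank_eq_one X, fun ⟨j, ⟨e⟩⟩ => ?_⟩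
  rw [LinearEquiv.finrank_eq (LinearEquiv.ofBijective e.hom.toLinearMap ((isIso_iff_bijective e.hom).1 inferInstance)), finrank_tateObj]

variable (X) in
/-- **The twist is unique**: a one-dimensional `X` is `≅ ℚ(j)` for exactly one `j`. [cite: DeligneHodgeII1971, 2.1.13] -/
theorem existsUnique_iso_tateObj_of_finrank_eq_one (hX : Module.finrank ℚ X = 1) : ∃! j : ℤ, Nonempty (X ≅ tateObj.{u} j) := by
  obtain ⟨j, ⟨e⟩⟩ := exists_iso_tateObj_of_finrank_eq_one X hX
  exact ⟨j, ⟨e⟩, fun j' ⟨e'⟩ => ((nonempty_tateObj_iso_tateObj_iff j' j).1 ⟨e'.symm ≪≫ e⟩)⟩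

/-! ## §2 Isomorphisms act on `⊗` and duals; dimensions -/

/-- `e₁ ⊗ e₂ : X ⊗ Y ≅ X' ⊗ Y'` for isomorphisms `e₁, e₂`. [cite: DeligneHodgeII1971, 1.1.12] -/
def tensorMapIso (e₁ : X ≅ X') (e₂ : Y ≅ Y') : tensorObj X Y ≅ tensorObj X' Y' where
  hom := tensorHom e₁.hom e₂.hom
  inv := tensorHom e₁.inv e₂.inv
  hom_inv_id := by rw [← tensorHom_comp, Iso.hom_inv_id, Iso.hom_inv_id, tensorHom_id]
  inv_hom_id := by rw [← tensorHom_comp, Iso.inv_hom_id, Iso.inv_hom_id, tensorHom_id]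

/-- Unfolding `tensorMapIso`. [cite: DeligneHodgeII1971, 1.1.12] -/
theorem tensorMapIso_hom (e₁ : X ≅ X') (e₂ : Y ≅ Y') : (tensorMapIso e₁ e₂).hom = tensorHom e₁.hom e₂.hom := rfl

/-- `(e^∨)⁻¹ : X^∨ ≅ X'^∨` for an isomorphism `e : X ≅ X'` (transposes of `e⁻¹` and `e`). [cite: DeligneHodgeII1971, 1.1.6] -/
def dualMapIso (e : X ≅ X') : of X.str.dual ≅ of X'.str.dual where
  hom := transposeHom e.inv
  inv := transposeHom e.hom
  hom_inv_id := by rw [← transposeHom_comp, Iso.hom_inv_id, transposeHom_id]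
  inv_hom_id := by rw [← transposeHom_comp, Iso.inv_hom_id, transposeHom_id]

/-- Unfolding `dualMapIso`. [cite: DeligneHodgeII1971, 1.1.6] -/
theorem dualMapIso_hom (e : X ≅ X') : (dualMapIso e).hom = transposeHom e.inv := rfl

variable (X Y) in
/-- `dim (X ⊗ Y) = dim X · dim Y`. [cite: DeligneHodgeII1971, 1.1.12] -/
theorem finrank_tensorObj : Module.finrank ℚ (tensorObj X Y) = Module.finrank ℚ X * Module.finrank ℚ Y := Module.finrank_tensorProduct

variable (X) in
/-- `dim X^∨ = dim X`. [cite: DeligneHodgeII1971, 1.1.6] -/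
theorem finrank_dualObj : Module.finrank ℚ (of X.str.dual) = Module.finrank ℚ X := Subspace.dual_finrank_eq

/-! ## §3 Invertible objects -/

variable (X) in
/-- `X ⊗ Y ≅ ℚ(0)` forces `dim X = 1`. [cite: DeligneMilne1982Tannakian, §1 (1.7)] -/
theorem finrank_eq_one_of_tensorObj_iso_unitObj (e : tensorObj X Y ≅ unitObj.{u}) : Module.finrank ℚ X = 1 := by
  have h := LinearEquiv.finrank_eq (LinearEquiv.ofBijective e.hom.toLinearMap ((isIso_iff_bijective e.hom).1 inferInstance))
  rw [finrank_tensorObj, finrank_unitObj] at h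
  exact Nat.eq_one_of_mul_eq_one_right h

variable (X) in
/-- **For `dim X = 1`: `X ⊗ X^∨ ≅ ℚ(0)`** (`X ≅ ℚ(j)`, `ℚ(j) ⊗ ℚ(j)^∨ ≅ ℚ(j) ⊗ ℚ(−j) ≅ ℚ(0)`, g45-#19). [cite: DeligneMilne1982Tannakian, §1 (1.7)] [cite: DeligneHodgeII1971, 2.1.13] -/
def tensorDualIsoUnitOfFinrankEqOne (hX : Module.finrank ℚ X = 1) : tensorObj X (of X.str.dual) ≅ unitObj.{u} :=
  let j := (exists_iso_tateObj_of_finrank_eq_one X hX).choose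
  let e : X ≅ tateObj.{u} j := (exists_iso_tateObj_of_finrank_eq_one X hX).choose_spec.some
  haveI := finite_tateObj.{u} j
  haveI := finite_tateObj.{u} (-j)
  tensorMapIso e (dualMapIso e) ≪≫ tensorMapIso (Iso.refl _) (tateDualIso.{u} j) ≪≫ tateMulIso.{u} j (-j) ≪≫ eqToIso (by rw [add_neg_cancel]; rfl)

variable (X) in
/-- **`X` is invertible iff `dim X = 1`** (iff `X ≅ ℚ(j)` for some `j`): `(∃ Y, X ⊗ Y ≅ ℚ(0)) ↔ dim X = 1`. [cite: DeligneMilne1982Tannakian, §1 (1.7)] [cite: DeligneHodgeII1971, 2.1.13] -/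
theorem exists_tensorObj_iso_unitObj_iff_finrank_eq_one :
    (∃ (Y : MixedHodgeStructureCat.{u}) (_ : Module.Finite ℚ Y), Nonempty (tensorObj X Y ≅ unitObj.{u})) ↔ Module.finrank ℚ X = 1 := by
  refine ⟨fun ⟨Y, _, ⟨e⟩⟩ => finrank_eq_one_of_tensorObj_iso_unitObj X e, fun hX => ⟨of X.str.dual, inferInstance, ⟨tensorDualIsoUnitOfFinrankEqOne X hX⟩⟩⟩

end MixedHodgeStructureCat

end Literature.AlgebraicGeometry.Motives
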